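import Summits.QuantumFields.YangMills.Theorems.FluctuationComparisonRegPrIntLLoopLedgerGasOfKPFamily
import HarnessLib

/-!
# THE PRODUCT-FORMULA DOOR OF LINE g19-2, KOTECKÝ–PREISS EDITION, AT DEPTH ONE: ⟨ECE₁-KP⟩ → ⟨GAS₁ VERBATIM⟩ (`K := J + 1`, ONE constrained fluctuation integral)

Cell `ym3-torus` (YM ladder rung R3 = continuum `SU(2)` Yang–Mills on the three-torus — a RUNG, NOT d = 4, NOT infinite volume, NOT a mass gap, NOT Clay).
Width seat `ym3-torus-px20` (gen 15); `--supports stmt-QuantumFields-20520 --as helper`, count-neutral, definition-free, default heartbeats; registry v11.4 №36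
untouched.  The depth-one twin of ✓`…LoopLedgerGasOfKPFamily.beyondOneLoopGas_of_productFormula_kp` (cut there for the 400-line lint): the hands' FIRST RUNG
`LoopLedgerDepthOneGasCan` (GAS₁ of `Lines/loop_ledger.lean` v6 §3d) from a per-λ PRODUCT FORMULA for ONE renormalisation transformation together with Kotecký–Preiss
majorants at every `λ ≥ 1` whose pinned size tends to zero — the native output of a one-step cluster expansion of the constrained fluctuation integral
([Balaban1985UV3] §A (25)–(37) in identity form; [Balaban1987RG1] (0.26)); `Ξ > 0` and `log Ξ(w^λ) → 0` by ✓`gasZ_pos_and_abs_log_le` ∕ ✓`tendsto_log_gasZ_of_kpFamily`.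
* ★★ `loopLedgerDepthOneGas_of_productFormula_kp : ⟨ECE₁-KP⟩ → ⟨LoopLedgerDepthOneGasCan VERBATIM (δ-unfolded)⟩`.

HONEST SCOPE.  Quantifier plumbing over the landed KP edition; ⟨ECE₁-KP⟩ is a HYPOTHESIS (XL: the one-step small-field cluster expansion with its majorants); nothing of
Bałaban's is asserted or proved; GAS₁, RUNG 1, REP, H4ᶜ, S2β and `FluctuationComparisonRegPrIntL` (stmt-QuantumFields-20520) are NOT proved; no summit statement is proved
by a helper; rung R3 = SU(2) YM₃ on T³ — NOT d = 4, NOT infinite volume, NOT a mass gap, NOT Clay; the Yang–Mills mass gap is NOT proved.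

References: T. Bałaban, CMP **102** (1985) 255–275 [Balaban1985UV3] ((25)–(37) pp.262–265); CMP **109** (1987) 249–301 [Balaban1987RG1] ((0.26) p.257); R. Kotecký,
D. Preiss, CMP **103** (1986) 491–498 [KoteckyPreiss1986] (Theorem p.492).
-/

set_option autoImplicit false

noncomputable section

open MeasureTheory Filter Topology Set
open Literature.Probability.LatticeModels
open Literature.MathematicalPhysics.QuantumFieldTheory.Balaban1983to89
open Literature.MathematicalPhysics.QuantumFieldTheory.Balaban1983to89.T3ContinuumYM3Torus
open Literature.MathematicalPhysics.QuantumFieldTheory.Balaban1983to89.T3NestedUnitLaws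
open Literature.MathematicalPhysics.QuantumFieldTheory.Balaban1983to89.T3UnitLawDensityEML
open Literature.MathematicalPhysics.QuantumFieldTheory.Balaban1983to89.T3UnitScaleTilt
open Literature.MathematicalPhysics.QuantumFieldTheory.Balaban1983to89.T3TiltDescent
open Literature.MathematicalPhysics.QuantumFieldTheory.Balaban1983to89.T3PrintedRegularMinimiser

namespace Summit.QuantumFields.YangMills.Theorems.LoopLedgerGasOfProductFormula

open Classical in
/-- ★★ **⟨ECE₁-KP⟩ → ⟨GAS₁⟩: THE DEPTH-ONE DOOR, KOTECKÝ–PREISS EDITION** (`K := J + 1`): GAS₁'s prefix VERBATIM; then per `J` a datum-free `Cl λ > 0`, a λ-free `ell > 0`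
on the window, real V-local activities `w λ`, a pinned-size profile `Nf λ → 0`, the `KPGasOn` text at `λ = 1` with size `Φ J` and at every `λ ≥ 1` with size `Nf λ`, and the
PRODUCT FORMULA for the one-step density; conclusion `LoopLedgerDepthOneGasCan` of LINE g19-2 VERBATIM (δ-unfolded).
[cite: Balaban1985UV3, (25)-(37) pp.262-265; Balaban1987RG1, (0.26) p.257; KoteckyPreiss1986, Theorem p.492] -/
theorem loopLedgerDepthOneGas_of_productFormula_kp
    (hECE : ∀ (L : ℕ), ∃ pS : ℝ, ∀ (b₀ p₀ : ℝ), 0 < b₀ → pS ≤ p₀ → 0 < p₀ → ∃ ε₁ : ℝ, 0 < ε₁ ∧ ∀ (ε₀ : ℝ), 0 < ε₀ → ε₀ ≤ ε₁ →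
      ∃ γ₁ : ℝ, 0 < γ₁ ∧ ∃ κ : ℝ, 0 < κ ∧
        ∀ (F : T3Family) (γ : ℝ), F.L = L → 0 < γ → γ ≤ γ₁ →
          ∃ Φ : ℕ → ℝ, (∀ J, 0 ≤ Φ J) ∧ Tendsto (fun J : ℕ => (J : ℝ) * Φ J) atTop (𝓝 0) ∧
            ∀ (J : ℕ),
              ∃ (Cl : ℝ → ℝ) (ell : GaugeField (F.P J) 0 (Matrix.specialUnitaryGroup (Fin 2) ℂ) → ℝ)
                (w : ℝ → GaugeField (F.P J) 0 (Matrix.specialUnitaryGroup (Fin 2) ℂ) → Finset (PBond (F.P J) 0) → ℝ) (Nf : ℝ → ℝ),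
              (∀ lam : ℝ, 1 ≤ lam → 0 < Cl lam) ∧
              (∀ U : GaugeField (F.P J) 0 (Matrix.specialUnitaryGroup (Fin 2) ℂ), PlaqSmall (θBal F.L γ b₀ p₀ J) U → 0 < ell U) ∧
              (∃ (wbar a ℓ : Finset (PBond (F.P J) 0) → ℝ),
                (∀ U, w 1 U ∅ = 0) ∧
                (∀ (X : Finset (PBond (F.P J) 0)) (U U' : GaugeField (F.P J) 0 (Matrix.specialUnitaryGroup (Fin 2) ℂ)),
                  (∀ e ∈ X, U e = U' e) → w 1 U X = w 1 U' X) ∧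
                (∀ X, 0 ≤ a X) ∧ (∀ X, 0 ≤ ℓ X) ∧
                (∀ U, U ∈ {U : GaugeField (F.P J) 0 (Matrix.specialUnitaryGroup (Fin 2) ℂ) | PlaqSmall (θBal F.L γ b₀ p₀ J) U} → ∀ X, |w 1 U X| ≤ wbar X) ∧
                (∀ X : Finset (PBond (F.P J) 0), ∀ e ∈ X, ∀ e' ∈ X, (e.src.tdist e'.src : ℝ) ≤ ℓ X) ∧
                (∀ X : Finset (PBond (F.P J) 0), ∑ X' ∈ Finset.univ.filter (fun X' => polyInc X' X),
                    wbar X' * Real.exp (a X' + κ * ℓ X') ≤ a X) ∧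
                (∀ e : PBond (F.P J) 0, a {e} ≤ (Φ J))) ∧
              Tendsto Nf atTop (𝓝 0) ∧
              (∀ lam : ℝ, 1 ≤ lam → (∃ (wbar a ℓ : Finset (PBond (F.P J) 0) → ℝ),
                (∀ U, w lam U ∅ = 0) ∧
                (∀ (X : Finset (PBond (F.P J) 0)) (U U' : GaugeField (F.P J) 0 (Matrix.specialUnitaryGroup (Fin 2) ℂ)),
                  (∀ e ∈ X, U e = U' e) → w lam U X = w lam U' X) ∧
                (∀ X, 0 ≤ a X) ∧ (∀ X, 0 ≤ ℓ X) ∧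
                (∀ U, U ∈ {U : GaugeField (F.P J) 0 (Matrix.specialUnitaryGroup (Fin 2) ℂ) | PlaqSmall (θBal F.L γ b₀ p₀ J) U} → ∀ X, |w lam U X| ≤ wbar X) ∧
                (∀ X : Finset (PBond (F.P J) 0), ∀ e ∈ X, ∀ e' ∈ X, (e.src.tdist e'.src : ℝ) ≤ ℓ X) ∧
                (∀ X : Finset (PBond (F.P J) 0), ∑ X' ∈ Finset.univ.filter (fun X' => polyInc X' X),
                    wbar X' * Real.exp (a X' + κ * ℓ X') ≤ a X) ∧
                (∀ e : PBond (F.P J) 0, a {e} ≤ Nf lam))) ∧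
              (∀ lam : ℝ, 1 ≤ lam → ∀ U : GaugeField (F.P J) 0 (Matrix.specialUnitaryGroup (Fin 2) ℂ), PlaqSmall (θBal F.L γ b₀ p₀ J) U →
                Node00.canonVersion (fieldMeasure (F.P J) 0 (Matrix.specialUnitaryGroup (Fin 2) ℂ))
                    (heightDensity F (γ / lam) (Nat.le_succ J) (histGood F ℰp (θBal F.L γ b₀ p₀) (J + 1) J)) U
                  * Real.exp ((F.scheme ℰp (γ / lam)).β (J + 1) * minActionRegPr F J (J + 1) (Nat.le_succ J) ε₀ U)
                = Cl lam * ell U * (polymerPartitionFunction polyInc (fun X : Finset (PBond (F.P J) 0) => ((w lam U X : ℝ) : ℂ)) Finset.univ).re)) :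
    ∀ (L : ℕ), ∃ pS : ℝ, ∀ (b₀ p₀ : ℝ), 0 < b₀ → pS ≤ p₀ → 0 < p₀ → ∃ ε₁ : ℝ, 0 < ε₁ ∧ ∀ (ε₀ : ℝ), 0 < ε₀ → ε₀ ≤ ε₁ →
      ∃ γ₁ : ℝ, 0 < γ₁ ∧ ∃ κ : ℝ, 0 < κ ∧
        ∀ (F : T3Family) (γ : ℝ), F.L = L → 0 < γ → γ ≤ γ₁ →
          ∃ Φ : ℕ → ℝ, (∀ J, 0 ≤ Φ J) ∧ Tendsto (fun J : ℕ => (J : ℝ) * Φ J) atTop (𝓝 0) ∧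
            ∀ (J : ℕ),
              ∃ (c : ℝ) (w : GaugeField (F.P J) 0 (Matrix.specialUnitaryGroup (Fin 2) ℂ) → Finset (PBond (F.P J) 0) → ℝ),
                (∃ (wbar a ℓ : Finset (PBond (F.P J) 0) → ℝ),
                (∀ U, w U ∅ = 0) ∧
                (∀ (X : Finset (PBond (F.P J) 0)) (U U' : GaugeField (F.P J) 0 (Matrix.specialUnitaryGroup (Fin 2) ℂ)),
                  (∀ e ∈ X, U e = U' e) → w U X = w U' X) ∧
                (∀ X, 0 ≤ a X) ∧ (∀ X, 0 ≤ ℓ X) ∧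
                (∀ U, U ∈ {U : GaugeField (F.P J) 0 (Matrix.specialUnitaryGroup (Fin 2) ℂ) | PlaqSmall (θBal F.L γ b₀ p₀ J) U} → ∀ X, |w U X| ≤ wbar X) ∧
                (∀ X : Finset (PBond (F.P J) 0), ∀ e ∈ X, ∀ e' ∈ X, (e.src.tdist e'.src : ℝ) ≤ ℓ X) ∧
                (∀ X : Finset (PBond (F.P J) 0), ∑ X' ∈ Finset.univ.filter (fun X' => polyInc X' X),
                    wbar X' * Real.exp (a X' + κ * ℓ X') ≤ a X) ∧
                (∀ e : PBond (F.P J) 0, a {e} ≤ (Φ J))) ∧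
                ∀ U : GaugeField (F.P J) 0 (Matrix.specialUnitaryGroup (Fin 2) ℂ), PlaqSmall (θBal F.L γ b₀ p₀ J) U →
                  (Real.log (Node00.canonVersion (fieldMeasure (F.P J) 0 (Matrix.specialUnitaryGroup (Fin 2) ℂ))
                      (heightDensity F (γ / 1) (Nat.le_succ J) (histGood F ℰp (θBal F.L γ b₀ p₀) (J + 1) J)) U)
                    + (F.scheme ℰp (γ / 1)).β (J + 1) * minActionRegPr F J (J + 1) (Nat.le_succ J) ε₀ U)
                    = c + limUnder atTop (fun lam : ℝ => (Real.log (Node00.canonVersion (fieldMeasure (F.P J) 0 (Matrix.specialUnitaryGroup (Fin 2) ℂ))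
                      (heightDensity F (γ / lam) (Nat.le_succ J) (histGood F ℰp (θBal F.L γ b₀ p₀) (J + 1) J)) U)
                    + (F.scheme ℰp (γ / lam)).β (J + 1) * minActionRegPr F J (J + 1) (Nat.le_succ J) ε₀ U) - (Real.log (Node00.canonVersion (fieldMeasure (F.P J) 0 (Matrix.specialUnitaryGroup (Fin 2) ℂ))
                      (heightDensity F (γ / lam) (Nat.le_succ J) (histGood F ℰp (θBal F.L γ b₀ p₀) (J + 1) J)) 1)
                    + (F.scheme ℰp (γ / lam)).β (J + 1) * minActionRegPr F J (J + 1) (Nat.le_succ J) ε₀ 1))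
                      + Real.log (polymerPartitionFunction polyInc (fun X : Finset (PBond (F.P J) 0) => ((w U X : ℝ) : ℂ)) Finset.univ).re := by
  intro L
  obtain ⟨pS, H⟩ := hECE L
  refine ⟨pS, fun b₀ p₀ hb hp hp0 => ?_⟩
  obtain ⟨ε₁, hε₁, H1⟩ := H b₀ p₀ hb hp hp0
  refine ⟨ε₁, hε₁, fun ε₀ hε₀ hε₀le => ?_⟩
  obtain ⟨γ₁, hγ₁, κ, hκ, H2⟩ := H1 ε₀ hε₀ hε₀le
  refine ⟨min γ₁ 1, lt_min hγ₁ one_pos, κ, hκ, fun F γ hFL hγ hγle => ?_⟩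
  obtain ⟨Φ, hΦ0, hΦ, H3⟩ := H2 F γ hFL hγ (hγle.trans (min_le_left _ _))
  refine ⟨Φ, hΦ0, hΦ, fun J => ?_⟩
  obtain ⟨Cl, ell, w, Nf, hCl, hell, hgas, hN, hgasL, hprod⟩ := H3 J
  have h1 : PlaqSmall (θBal F.L γ b₀ p₀ J) (1 : GaugeField (F.P J) 0 (Matrix.specialUnitaryGroup (Fin 2) ℂ)) :=
    T3DescentFibreTower.plaqSmall_one (T3MinimiserStabilityReduction.θBal_pos (le_of_lt F.hL.2) hγ (hγle.trans (min_le_right _ _)) hb p₀ J)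
  have hdata : ∀ U : GaugeField (F.P J) 0 (Matrix.specialUnitaryGroup (Fin 2) ℂ), PlaqSmall (θBal F.L γ b₀ p₀ J) U → ∀ lam : ℝ, 1 ≤ lam →
      ∃ (wbar a ℓ : Finset (PBond (F.P J) 0) → ℝ),
        w lam U ∅ = 0 ∧ (∀ X, 0 ≤ ℓ X) ∧ (∀ X, |w lam U X| ≤ wbar X) ∧
        (∀ X : Finset (PBond (F.P J) 0), ∑ X' ∈ Finset.univ.filter (fun X' => polyInc X' X),
            wbar X' * Real.exp (a X' + κ * ℓ X') ≤ a X) ∧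
        (∀ e : PBond (F.P J) 0, a {e} ≤ Nf lam) := by
    intro U hU lam hlam
    obtain ⟨wbar, a, ℓ, hw0, -, -, hℓ, hdom, -, hKP, hpin⟩ := hgasL lam hlam
    exact ⟨wbar, a, ℓ, hw0 U, hℓ, hdom U hU, hKP, hpin⟩
  have hZpos : ∀ lam : ℝ, 1 ≤ lam → ∀ U : GaugeField (F.P J) 0 (Matrix.specialUnitaryGroup (Fin 2) ℂ), PlaqSmall (θBal F.L γ b₀ p₀ J) U →
      0 < (polymerPartitionFunction polyInc (fun X : Finset (PBond (F.P J) 0) => ((w lam U X : ℝ) : ℂ)) Finset.univ).re := by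
    intro lam hlam U hU
    obtain ⟨wbar, a, ℓ, hw0, hℓ, hdom, hKP, hpin⟩ := hdata U hU lam hlam
    exact (gasZ_pos_and_abs_log_le hκ.le (w lam) wbar a ℓ U hw0 hℓ hdom hKP hpin).1
  have hlim : ∀ U : GaugeField (F.P J) 0 (Matrix.specialUnitaryGroup (Fin 2) ℂ), PlaqSmall (θBal F.L γ b₀ p₀ J) U →
      Tendsto (fun lam : ℝ => Real.log (polymerPartitionFunction polyInc (fun X : Finset (PBond (F.P J) 0) => ((w lam U X : ℝ) : ℂ)) Finset.univ).re) atTop (𝓝 0) :=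
    fun U hU => tendsto_log_gasZ_of_kpFamily hκ.le Nf hN w U (hdata U hU)
  refine ⟨Real.log (Cl 1) + Real.log (ell 1), w 1, hgas, fun U hU => ?_⟩
  have hsplit : ∀ lam : ℝ, 1 ≤ lam → ∀ U, U ∈ {U : GaugeField (F.P J) 0 (Matrix.specialUnitaryGroup (Fin 2) ℂ) | PlaqSmall (θBal F.L γ b₀ p₀ J) U} →
      (fun (lam : ℝ) (U : GaugeField (F.P J) 0 (Matrix.specialUnitaryGroup (Fin 2) ℂ)) =>
          Real.log (Node00.canonVersion (fieldMeasure (F.P J) 0 (Matrix.specialUnitaryGroup (Fin 2) ℂ))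
              (heightDensity F (γ / lam) (Nat.le_succ J) (histGood F ℰp (θBal F.L γ b₀ p₀) (J + 1) J)) U)
            + (F.scheme ℰp (γ / lam)).β (J + 1) * minActionRegPr F J (J + 1) (Nat.le_succ J) ε₀ U) lam U
        = (fun lam : ℝ => Real.log (Cl lam)) lam + (fun U => Real.log (ell U)) U
          + (fun (lam : ℝ) (U : GaugeField (F.P J) 0 (Matrix.specialUnitaryGroup (Fin 2) ℂ)) => Real.log (polymerPartitionFunction polyInc (fun X : Finset (PBond (F.P J) 0) => ((w lam U X : ℝ) : ℂ)) Finset.univ).re) lam U :=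
    fun lam hlam U hU => log_add_eq_of_mul_exp_eq (hCl lam hlam) (hell U hU) (hZpos lam hlam U hU) (hprod lam hlam U hU)
  exact eq_const_add_limUnder_add_of_split hsplit (fun U hU => hlim U hU) hU h1

end Summit.QuantumFields.YangMills.Theorems.LoopLedgerGasOfProductFormula

end
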